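import Literature.AlgebraicGeometry.AbelianSchemes.DualIsogenyBaseChange
import Literature.AlgebraicGeometry.AbelianSchemes.AbelianSchemeFixedPowBaseChange
import Literature.AlgebraicGeometry.Resolution.SchematicallyDense
import Literature.NumberTheory.EllipticCurves.NeronModelAbelianScheme
import HarnessLib

/-!
# Homomorphisms of abelian schemes are detected after a schematically dominant base change — in particular on the
# GENERIC FIBRE of a flat base over a domain — and so is the ROSATI condition `ι(b̄) ≫ λ = λ ≫ ι(b)^∨` (for ANY dual pair)

Topic `AlgebraicGeometry/AbelianSchemes`; namespace `Literature.AlgebraicGeometry.AbelianSchemes.AbelianSchemeOver(.DualPair ∕ .RingAction)`.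
THEOREMS ONLY (no definition, no structure, no instance, no named fact, no `sorry`); books 0.

Cell hodgecm-mathlib (D-0151), P6 «MOD programme», (s2-D)∕SP1-ρ∕λ «DualPair ∕ Polarization spread ADAPTER» (GEN census
`CENSUS-RGD-ASSEMBLY.v1` row (vi)∕(i) SP1-ρ∕λ; B-p04 (g40) offer (O1) 23:20Z).  On the road of record (LEAD «M-29») the stage dual pair
of the GEN spine is the LETTER's `dual := dualPairOf hDUALS univ` over `𝓨 = (𝓜.localise w).total` (flat, proper over the DVR
`Spec 𝒪_{F,(w)}`), the polarisation `pol.lam : univ → dual.hat` is built at the stage (Θ-SPREAD), and the law `RGDInputsAt.rosati`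
(`ι(b̄) ≫ λ = λ ≫ ι(b)^∨`, `^∨` = ★ `DualPair.dualIsogenyOver … dual dual`) is KNOWN on the generic fibre (E-line `stub_E6`, transported).
This file is the descent step «generic fibre ⇒ stage», by schematic density — no spreading, no shrinking of the stage, every `b` at once:
* §1 **`hom_ext_of_baseChangeHom_eq`** — for `ι : T → S` scheme-theoretically dominant and quasi-compact and abelian schemes `A, B`
  over `S`, two `S`-morphisms `f g : A.X ⟶ B.X` with `f ×_S T = g ×_S T` (★ `baseChangeHom`) are EQUAL: `A ×_S T → A` is
  scheme-theoretically dominant (Mathlib `IsSchemeTheoreticallyDominant.pullbackFst`, `A → S` flat) and `B → S` is separated, so ★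
  `Resolution.ext_of_isSchemeTheoreticallyDominant_of_isSeparated` ([GortzWedhorn2020] Prop. 9.19) applies (naturality ★ `baseChangeHom_left_comp_fst`);
  `hom_ext_of_fst_comp_eq` is the same with the hypothesis on underlying schemes;
* §2 **the generic fibre of a flat `R`-scheme**: for a domain `R` with fraction field `K` and `Y : Over (Spec R)` flat, the inclusion
  `ι_η := pullback.fst Y.hom (Spec K → Spec R) : Y_K → Y` is scheme-theoretically dominant (★ `isSchemeTheoreticallyDominant_pullback_fst_specGenericPoint`,
  [GortzWedhorn2020] Lemma 14.6) and quasi-compact, whence **`hom_ext_of_baseChangeHom_genericFibre_eq`** for abelian schemes over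
  `Y.left` ([BLRNeronModels1990] §1.2: uniqueness half of the Néron property, here over a non-affine flat base);
* §3 **base change of the dual homomorphism in `Over` currency**: `baseChangeHom (ψ^∨) g = (baseChangeHom ψ g)^∨` formed with the
  base-changed dual pairs (`baseChangeHom_dualIsogenyOver`; ★ `dualIsogeny_baseChange_eq_lift`, [MumfordFogartyKirwan1994] Cor. 6.8);
* §4 **ROSATI IS DETECTED AFTER A SCHEMATICALLY DOMINANT BASE CHANGE** (`comp_eq_comp_dualIsogenyOver_of_baseChange`, atomic form with
  arbitrary homomorphisms `α β : A → A`, any `lam : A → Â`, ANY dual pair `D`; `RingAction.rosati_of_baseChange` in the ★ `RingAction.baseChange`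
  currency `(act.baseChange ι).i b = baseChangeHom (act.i b) ι`; and the generic-fibre specialisations `…_genericFibre…`) — the exact
  shape of `RGDInputsAt.rosati` ([RapoportSmithlingZhang2020Diagonal] §3.2 (Rosati condition of the PEL datum); [Kottwitz1992] §5).
HC_CM is proved only modulo the printed citations (2 remaining named inputs hLiu418 24832, h413 24833) until rung 0 closes; this file is
count-neutral and discharges none of them.

## References
* [GortzWedhorn2020] U. Görtz, T. Wedhorn, *Algebraic Geometry I*, 2nd ed. (2020), Prop. 9.19 (pp. 236–237) (morphisms to a separated scheme
  agreeing on a schematically dense subscheme agree), Lemma 14.6 (schematic density under flat base change), Section (4.7) (base change).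
* [BLRNeronModels1990] S. Bosch, W. Lütkebohmert, M. Raynaud, *Néron Models* (1990), §1.2 (Def. 1 and the remark after it; Prop. 8)
  (the generic fibre of a flat `R`-scheme is schematically dense; uniqueness of extensions).
* [MumfordFogartyKirwan1994] D. Mumford, J. Fogarty, F. Kirwan, *Geometric Invariant Theory*, 3rd ed. (1994), Ch. 6 §1 Cor. 6.4 (p. 117),
  Cor. 6.8 (p. 118) (the dual commutes with base change).
* [RapoportSmithlingZhang2020Diagonal] M. Rapoport, B. Smithling, W. Zhang, *Arithmetic diagonal cycles on unitary Shimura varieties*,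
  Compos. Math. 156 (2020), §3.2 (the Rosati condition `ι(b̄) = λ⁻¹ ∘ ι(b)^∨ ∘ λ` of the moduli problem).
* [Kottwitz1992] R. Kottwitz, *Points on some Shimura varieties over finite fields*, JAMS 5 (1992), §5 (pp. 389–391).
* [MumfordAV1970] D. Mumford, *Abelian Varieties* (1970), §15 Thm. 1 (p. 143) (`f ↦ f^∨`), §20 (Rosati involution).
* Tree: ★ `Resolution.SchematicallyDense` (`ext_of_isSchemeTheoreticallyDominant_of_isSeparated`), ★ `NumberTheory.EllipticCurves.NeronModelAbelianScheme`
  (`isSchemeTheoreticallyDominant_pullback_fst_specGenericPoint`, `specGenericPoint`), ★ `RigidifiedLineBundleComapHom` (`baseChangeHom`,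
  `isMonHom_baseChangeHom`), ★ `DualIsogenyBaseChange` (`dualIsogeny_baseChange_eq_lift`), ★ `AbelianSchemeDualIsogeny` (`dualIsogenyOver`),
  ★ `AbelianSchemeFixedPowBaseChange` (`RingAction.baseChange`, `RingAction.baseChange_i`).
-/

set_option autoImplicit false

noncomputable section

universe u

open CategoryTheory CategoryTheory.Limits AlgebraicGeometry

namespace Literature.AlgebraicGeometry.AbelianSchemes

namespace AbelianSchemeOver

/-! ### §1 Morphisms of abelian schemes are detected after a scheme-theoretically dominant quasi-compact base change -/

section Dominant

variable {S T : Scheme.{u}} (ι : T ⟶ S) [IsSchemeTheoreticallyDominant ι] [QuasiCompact ι] {A B : AbelianSchemeOver S}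

/-- `A ×_S T → A` is scheme-theoretically dominant for `ι : T → S` scheme-theoretically dominant quasi-compact (`A → S` is flat).
[cite: GortzWedhorn2020, Lemma 14.6] -/
theorem isSchemeTheoreticallyDominant_fst_baseChange : IsSchemeTheoreticallyDominant (pullback.fst A.X.hom ι) := by
  haveI : Smooth A.X.hom := A.isSmooth
  haveI : Flat A.X.hom := inferInstance
  infer_instance

/-- **Two `S`-morphisms between abelian schemes agreeing after composition with `A ×_S T → A` are equal** (`B → S` separated; ★
`ext_of_isSchemeTheoreticallyDominant_of_isSeparated`). [cite: GortzWedhorn2020, Prop. 9.19 (pp. 236–237); Lemma 14.6] -/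
theorem hom_ext_of_fst_comp_eq (f g : A.X ⟶ B.X)
    (h : pullback.fst A.X.hom ι ≫ f.left = pullback.fst A.X.hom ι ≫ g.left) : f = g := by
  haveI : IsProper B.X.hom := B.isProper
  haveI := isSchemeTheoreticallyDominant_fst_baseChange ι (A := A)
  ext : 1
  exact Literature.AlgebraicGeometry.Resolution.ext_of_isSchemeTheoreticallyDominant_of_isSeparated B.X.hom
    (by rw [Over.w f, Over.w g]) (pullback.fst A.X.hom ι) h

/-- **Two `S`-morphisms `f g : A → B` between abelian schemes with the same base change `f ×_S T = g ×_S T` along a scheme-theoretically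
dominant quasi-compact `ι : T → S` are EQUAL.** [cite: GortzWedhorn2020, Prop. 9.19 (pp. 236–237); Lemma 14.6] [cite: BLRNeronModels1990, §1.2 Prop. 8] -/
theorem hom_ext_of_baseChangeHom_eq (f g : A.X ⟶ B.X) (h : baseChangeHom f ι = baseChangeHom g ι) : f = g := by
  refine hom_ext_of_fst_comp_eq ι f g ?_
  have hf := baseChangeHom_left_comp_fst f ι
  have hg := baseChangeHom_left_comp_fst g ι
  rw [← hf, ← hg, h]

/-- Iff form. [cite: GortzWedhorn2020, Prop. 9.19 (pp. 236–237)] -/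
theorem baseChangeHom_eq_iff (f g : A.X ⟶ B.X) : baseChangeHom f ι = baseChangeHom g ι ↔ f = g :=
  ⟨hom_ext_of_baseChangeHom_eq ι f g, fun h => h ▸ rfl⟩

end Dominant

/-! ### §2 The generic fibre of a flat scheme over a domain -/

section GenericFibre

open Literature.NumberTheory.EllipticCurves

variable (R : Type u) [CommRing R] (K : Type u) [Field K] [Algebra R K] [IsFractionRing R K]
  (Y : Over (Spec (.of R))) [Flat Y.hom]

/-- The generic-fibre inclusion `Y_K → Y` of a flat `R`-scheme is scheme-theoretically dominant (★, [GortzWedhorn2020] Lemma 14.6) — as an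
instance-shaped theorem on `pullback.fst Y.hom (specGenericPoint R K)`. [cite: GortzWedhorn2020, Lemma 14.6] [cite: BLRNeronModels1990, §1.2, remark after Def. 1] -/
theorem isSchemeTheoreticallyDominant_genericFibre_fst :
    IsSchemeTheoreticallyDominant (pullback.fst Y.hom (specGenericPoint R K)) :=
  isSchemeTheoreticallyDominant_pullback_fst_specGenericPoint R K Y

omit [IsFractionRing R K] [Flat Y.hom] in
/-- `Y_K → Y` is quasi-compact (base change of the affine morphism `Spec K → Spec R`). [cite: GortzWedhorn2020, Section (4.7)] -/
theorem quasiCompact_genericFibre_fst : QuasiCompact (pullback.fst Y.hom (specGenericPoint R K)) :=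
  inferInstance

/-- **Homomorphisms of abelian schemes over a flat `R`-scheme `Y` are detected on the generic fibre `Y_K`**: two `Y`-morphisms `f g : A → B`
with `f ×_Y Y_K = g ×_Y Y_K` are equal. [cite: BLRNeronModels1990, §1.2 Prop. 8] [cite: GortzWedhorn2020, Prop. 9.19 (pp. 236–237); Lemma 14.6] -/
theorem hom_ext_of_baseChangeHom_genericFibre_eq {A B : AbelianSchemeOver Y.left} (f g : A.X ⟶ B.X)
    (h : baseChangeHom f (pullback.fst Y.hom (specGenericPoint R K)) = baseChangeHom g (pullback.fst Y.hom (specGenericPoint R K))) :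
    f = g :=
  haveI := isSchemeTheoreticallyDominant_genericFibre_fst R K Y
  hom_ext_of_baseChangeHom_eq _ f g h

end GenericFibre

/-! ### §3 Base change of the dual homomorphism, `Over` currency -/

section DualBaseChange

variable {S T : Scheme.{u}} (ι : T ⟶ S) {A B : AbelianSchemeOver S} (ψ : A.X ⟶ B.X) [IsMonHom ψ]
  (DA : A.DualPair) (DB : B.DualPair)

/-- **`(ψ^∨) ×_S T = (ψ ×_S T)^∨`** with respect to the base-changed dual pairs (★ `dualIsogeny_baseChange_eq_lift` read in `Over T`).
[cite: MumfordFogartyKirwan1994, Ch. 6 §1 Cor. 6.8 (p. 118)] [cite: MumfordAV1970, §15 Thm. 1 (p. 143)] -/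
theorem baseChangeHom_dualIsogenyOver :
    baseChangeHom (DualPair.dualIsogenyOver ψ DA DB) ι =
      @DualPair.dualIsogenyOver T (A.baseChange ι) (B.baseChange ι) (baseChangeHom ψ ι) (isMonHom_baseChangeHom ψ ι)
        (DA.baseChange ι) (DB.baseChange ι) := by
  haveI := isMonHom_baseChangeHom ψ ι
  ext : 1
  rw [DualPair.dualIsogenyOver_left, DualPair.dualIsogeny_baseChange_eq_lift]
  simp only [Over.pullback_map_left]
  rfl

end DualBaseChange

/-! ### §4 The Rosati condition is detected after a scheme-theoretically dominant base change -/

section Rosati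

variable {S T : Scheme.{u}} (ι : T ⟶ S) [IsSchemeTheoreticallyDominant ι] [QuasiCompact ι] {A : AbelianSchemeOver S}

/-- **ROSATI, ATOMIC FORM**: for homomorphisms `α β : A → A`, a dual pair `D` (ANY — e.g. the letter's `dualPairOf h A`) and `lam : A → Â`,
if `α_T ≫ lam_T = lam_T ≫ (β_T)^∨` over `T` (duals w.r.t. `D ×_S T`) then `α ≫ lam = lam ≫ β^∨` over `S`.
[cite: RapoportSmithlingZhang2020Diagonal, §3.2] [cite: GortzWedhorn2020, Prop. 9.19 (pp. 236–237)] [cite: MumfordFogartyKirwan1994, Ch. 6 §1 Cor. 6.8 (p. 118)] -/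
theorem comp_eq_comp_dualIsogenyOver_of_baseChange (D : A.DualPair) (lam : A.X ⟶ D.hat.X) (α β : A.X ⟶ A.X) [IsMonHom β]
    (h : baseChangeHom α ι ≫ baseChangeHom lam ι =
      baseChangeHom lam ι ≫ @DualPair.dualIsogenyOver T (A.baseChange ι) (A.baseChange ι) (baseChangeHom β ι)
        (isMonHom_baseChangeHom β ι) (D.baseChange ι) (D.baseChange ι)) :
    α ≫ lam = lam ≫ DualPair.dualIsogenyOver β D D := by
  refine hom_ext_of_baseChangeHom_eq ι (B := D.hat) _ _ ?_
  change (Over.pullback ι).map (α ≫ lam) = (Over.pullback ι).map (lam ≫ DualPair.dualIsogenyOver β D D)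
  rw [Functor.map_comp, Functor.map_comp]
  change baseChangeHom α ι ≫ baseChangeHom lam ι = baseChangeHom lam ι ≫ baseChangeHom (DualPair.dualIsogenyOver β D D) ι
  rw [baseChangeHom_dualIsogenyOver ι β D D]
  exact h

variable {O : Type*} [CommRing O]

/-- **ROSATI FOR A RING ACTION is detected after a scheme-theoretically dominant base change** — the shape of `RGDInputsAt.rosati`: if
`ι_T(b') ≫ lam_T = lam_T ≫ ι_T(b)^∨` for the base-changed action ★ `act.baseChange ι` and dual pair `D ×_S T`, then
`ι(b') ≫ lam = lam ≫ ι(b)^∨`. [cite: RapoportSmithlingZhang2020Diagonal, §3.2] [cite: Kottwitz1992, §5 (pp. 389–391)] [cite: GortzWedhorn2020, Prop. 9.19 (pp. 236–237)] -/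
theorem RingAction.rosati_of_baseChange (act : A.RingAction O) (D : A.DualPair) (lam : A.X ⟶ D.hat.X) (b b' : O)
    (h : haveI := (act.baseChange ι).isMonHom b
      (act.baseChange ι).i b' ≫ baseChangeHom lam ι =
        baseChangeHom lam ι ≫ DualPair.dualIsogenyOver ((act.baseChange ι).i b) (D.baseChange ι) (D.baseChange ι)) :
    haveI := act.isMonHom b
    act.i b' ≫ lam = lam ≫ DualPair.dualIsogenyOver (act.i b) D D := by
  haveI := act.isMonHom b
  exact comp_eq_comp_dualIsogenyOver_of_baseChange ι D lam (act.i b') (act.i b) h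

end Rosati

/-! ### §4′ The generic-fibre specialisations (the P6 stage `𝓨 = (𝓜.localise w).total` over the DVR `𝒪_{F,(w)}`) -/

section RosatiGeneric

open Literature.NumberTheory.EllipticCurves

variable (R : Type u) [CommRing R] (K : Type u) [Field K] [Algebra R K] [IsFractionRing R K]
  (Y : Over (Spec (.of R))) [Flat Y.hom] {A : AbelianSchemeOver Y.left} {O : Type*} [CommRing O]

/-- **ROSATI ON THE STAGE FROM ROSATI ON THE GENERIC FIBRE** (atomic form), `ι_η = pullback.fst Y.hom (Spec K → Spec R)`.
[cite: RapoportSmithlingZhang2020Diagonal, §3.2] [cite: BLRNeronModels1990, §1.2 Prop. 8] -/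
theorem comp_eq_comp_dualIsogenyOver_of_genericFibre (D : A.DualPair) (lam : A.X ⟶ D.hat.X) (α β : A.X ⟶ A.X) [IsMonHom β]
    (h : baseChangeHom α (pullback.fst Y.hom (specGenericPoint R K)) ≫ baseChangeHom lam (pullback.fst Y.hom (specGenericPoint R K)) =
      baseChangeHom lam (pullback.fst Y.hom (specGenericPoint R K)) ≫
        @DualPair.dualIsogenyOver _ (A.baseChange _) (A.baseChange _) (baseChangeHom β (pullback.fst Y.hom (specGenericPoint R K)))
          (isMonHom_baseChangeHom β _) (D.baseChange _) (D.baseChange _)) :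
    α ≫ lam = lam ≫ DualPair.dualIsogenyOver β D D :=
  haveI := isSchemeTheoreticallyDominant_genericFibre_fst R K Y
  comp_eq_comp_dualIsogenyOver_of_baseChange _ D lam α β h

/-- **`RGDInputsAt.rosati` FROM THE GENERIC FIBRE**: the ring-action form over the flat `R`-scheme `Y`.
[cite: RapoportSmithlingZhang2020Diagonal, §3.2] [cite: Kottwitz1992, §5 (pp. 389–391)] [cite: BLRNeronModels1990, §1.2 Prop. 8] -/
theorem RingAction.rosati_of_genericFibre (act : A.RingAction O) (D : A.DualPair) (lam : A.X ⟶ D.hat.X) (b b' : O)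
    (h : haveI := (act.baseChange (pullback.fst Y.hom (specGenericPoint R K))).isMonHom b
      (act.baseChange (pullback.fst Y.hom (specGenericPoint R K))).i b' ≫ baseChangeHom lam (pullback.fst Y.hom (specGenericPoint R K)) =
        baseChangeHom lam (pullback.fst Y.hom (specGenericPoint R K)) ≫
          DualPair.dualIsogenyOver ((act.baseChange (pullback.fst Y.hom (specGenericPoint R K))).i b) (D.baseChange _) (D.baseChange _)) :
    haveI := act.isMonHom b
    act.i b' ≫ lam = lam ≫ DualPair.dualIsogenyOver (act.i b) D D :=
  haveI := isSchemeTheoreticallyDominant_genericFibre_fst R K Y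
  RingAction.rosati_of_baseChange _ act D lam b b' h

end RosatiGeneric

end AbelianSchemeOver

end Literature.AlgebraicGeometry.AbelianSchemes

end
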